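/-
Copyright (c) 2026 the pub-hodgecm-mathlib formalisation cell (harness21).  Prover seat hodgecm-mathlib-F0P3b-p01 (g12), 2026-09-01.  Road «S3-tree», brick T3′
«DEPTH-ZERO κ-TRANSFER», population P-2, organ R2² [T2-a] «SELF-DUAL CYCLIC LATTICES, OPERATOR CURRENCY» (architect A-p16 (g30) A-117 (1), A-128 «SWAP»).
-/
import Literature.NumberTheory.Automorphic.FixedCosetsStableLattices      -- ★ lattice dictionary `Λ(g)`, `Λ(gh) = g·Λ(h)`, `Λ(g) = Λ(g′) ↔ g⁻¹g′ ∈ GL_n(𝒪)`, ★ L1 docking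
import Literature.GroupTheory.TorsorImageCount                             -- ★ (c1) the abstract torsor count (F0P3-p03 (g13))
import HarnessLib

/-!
# Self-dual cyclic lattices of a regular element are a torsor: `#{Λ self-dual, Λ = ⊕ 𝒪·τ^j w} = [C : R^×]` in OPERATOR currency
# (Jacobowitz 1962 §7; Serre, *Trees* II §1.1; Rogawski 1990 §4.9 Lemma 4.9.3)

Topic `NumberTheory/Automorphic`; namespace `Literature.NumberTheory.Automorphic`.  THEOREMS ONLY (no definition, no instance, no notation, no named fact, no `sorry`).
Cell `pub/hodgecm-mathlib` (D-0151), crux H413 = `stmt-HodgeConjecture-24833`; road «S3-tree», brick T3′ «DEPTH-ZERO κ-TRANSFER» (architect A-p16 (g30)), population P-2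
(`stub_T3prime_typeTwo`), organ **R2² [T2-a]** (A-117 (1), A-128 «SWAP»: F0P3b-p01 (g12) on the carrier-free cut; [T2-b] B-p14 (g37), [T2-c]∕[T2-d] A-p19 (g26)).
HONEST LABEL: HC_CM is proved only modulo the printed citations (2 remaining named inputs hLiu418 24832, h413 24833) until rung 0 closes; elementary lattice algebra, asserts
nothing printed.

THE MATHEMATICS (any field `E` with a `ValuativeRel`, any `n`).  `τ ∈ GL_n(E)` with INTEGRAL characteristic polynomial and a CYCLIC vector `w₀` (the Krylov matrix
`K(w₀) = [w₀ | τw₀ | … | τⁿ⁻¹w₀]` is invertible); `L(w) := ⊕_{j<n} 𝒪·τ^j w` (★ `ncard_fixedBy_unitary_rank_eq_ncard_free'`'s cyclic lattices).  The CARRIER is abstract: ANY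
commutative `E`-algebra `B` with an INJECTIVE `E`-algebra map `φ : B → M_n(E)` hitting `τ = φ τ_B` (so `φ(B) = E[τ]`, the commutant of the regular `τ`), an involution-like
ring map `⋆ : B → B` intertwining the `J`-adjoint (`J·φ(b⋆) = σ(φ b)ᵀ·J`), and a subring `R_B ≤ B` with `φ(R_B) = 𝒪[τ]` (the ORDER).  Tokens: `R_B^× := R_B.toSubmonoid.units ≤ Bˣ`,
`N := id · (⋆ on units) : Bˣ →* Bˣ` (`N c = c·c⋆`; `Bˣ` is commutative), `C := R_B^×.comap N` = `{c : c c⋆ ∈ R_B^×}`.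
(§1) `L(a w) = a·L(w)` for `a` commuting with `τ`; `𝒪[τ]·L(w) ≤ L(w)` (Cayley–Hamilton with integral coefficients); the cyclic-vector torsor: every `w` is `r w₀` for a unique
`r ∈ E[τ]` (`r = Σ c_j τ^j`, `c = K(w₀)⁻¹ w`), `w` cyclic iff `r` is a unit; the STABILISER of `L(w₀)` in `E[τ]` is `𝒪[τ]`; a full lattice `Λ(g) = L(w)` forces `w` cyclic.
(§2) GOOD `b ∈ Bˣ` :⟺ `L(φ(b) w₀)` is self-dual (`= Λ(u)`, `u ∈ U(σ,J)`).  For `c ∈ C` and good `b`, `c b` is good: `Λ(φ(c)u)` has Gram matrix `J·u⁻¹ρu`, `ρ = φ(N c) ∈ 𝒪[τ]^×`,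
and `u⁻¹ρu ∈ GL_n(𝒪)` because `ρ` stabilises the `𝒪[τ]`-module `Λ(u) = L(φ b w₀)` (★ L1 docking).  Two good `b₀, b₁` differ by `c = b₁b₀⁻¹ ∈ C`: `u₁ = φ(c)u₀k`, `k ∈ GL_n(𝒪)`,
and unitarity of `u₀, u₁` gives `u₀⁻¹ ρ u₀ ∈ GL_n(𝒪)`, so `ρ` stabilises `L(φ b₀ w₀)`, hence `L(w₀)`, hence `ρ^{±1} ∈ 𝒪[τ]`, i.e. `N c ∈ R_B^×`.  Fibres: `L(φ(cb₀)w₀) = L(φ(c′b₀)w₀)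
⟺ c⁻¹c′ ∈ R_B^×` (stabiliser).  Every member of the ★ rider's set is `L(w)` with `w` cyclic, `w = φ(b) w₀`.  Hence (★ (c1) `natCard_range_eq_relIndex_of_fibres`)
**`#{Λ | (∃ u ∈ U(σ,J), Λ = Λ(u)) ∧ ∃ w, Λ = ⊕ 𝒪·τ^j w} = R_B^×.relIndex C`** as soon as ONE good `b₀` exists (`ncard_setOf_selfDual_cyclic_eq_relIndex`); and the set is empty iff
no good `b` exists (`exists_units_of_mem`).  What it leaves to [T2-b]∕[T2-c]∕[T2-d] (type (2): `B = L_w × K₁`, `⋆ = (σ_w, σ̃)`, `R_B = 𝒪_w[(u, λ₁)]`): «a good class exists iff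
`κ = (−1)^n`» and `R_B^×.relIndex C = (q+1)q^{N+n−1}`.

* §1 `span_range_pow_mulVec_eq_span_range_transpose`, `map_span_range_pow_mulVec_of_commute`, `map_span_range_pow_mulVec_le_of_mem_adjoin`,
  `map_span_range_pow_mulVec_eq_of_mem_units_adjoin`, `mul_krylov_eq_of_commute`, `eq_zero_of_commute_of_mulVec_eq_zero`, `exists_sum_smul_pow_mulVec_eq`,
  `mem_adjoin_integer_of_commute_of_map_le`, `isUnit_det_of_span_range_transpose_eq`, `nonsing_inv_mem_adjoin`.
* §2 `formCongr_eq_mul_of_adjoint`, `formCongr_mul_of_mem_unitary`, `commute_map_of_eq`, `map_span_range_pow_mulVec_eq_of_mem_units`, `mem_units_of_map_span_eq`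
  (the stabiliser on units), `good_mul_of_mem_comap` (C-stability), `map_span_eq_self_of_map_span_mul_eq` (cancellation), `mul_inv_mem_comap_of_good_of_good`
  (transitivity), `span_eq_span_iff_inv_mul_mem_units` (fibres), `exists_units_of_mem` (exhaustion), **`ncard_setOf_selfDual_cyclic_eq_relIndex`** (the count).

## References
* [Jacobowitz1962] R. Jacobowitz, *Hermitian forms over local fields*, Amer. J. Math. 84 (1962): §7 (unimodular lattices; lattices of a type as a units-torsor).
* [Serre1980Trees] J.-P. Serre, *Trees* (1980): Ch. II §1.1 (lattice classes counted by stabilisers).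
* [Rogawski1990] J. D. Rogawski, *Automorphic Representations of Unitary Groups in Three Variables* (1990): §4.9 Lemma 4.9.3 p. 56 (orbital integrals as lattice counts).
* [HornJohnson2013] R. A. Horn, C. R. Johnson, *Matrix Analysis* (2nd ed. 2013): Thm 2.4.3.2 (Cayley–Hamilton), §3.2.4 (non-derogatory matrices: the commutant is `E[τ]`).
-/

set_option autoImplicit false

noncomputable section

open Matrix Polynomial
open scoped MatrixGroups ValuativeRel

namespace Literature.NumberTheory.Automorphic

open Literature.NumberTheory.Automorphic.UnitaryGroup

/-! ## §1 Cyclic lattices `L(w) = ⊕_{j<n} 𝒪·τ^j w`: Krylov frames, `𝒪[τ]`-stability, the cyclic-vector torsor, the stabiliser -/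

section Cyclic

variable {F : Type*} [Field F] [ValuativeRel F] {n : ℕ}

/-- `L(w)` is the column span of the Krylov matrix `K(w) = [w | τw | … | τⁿ⁻¹w]`. [cite: HornJohnson2013, §3.2.4] -/
theorem span_range_pow_mulVec_eq_span_range_transpose (τ : Matrix (Fin n) (Fin n) F) (w : Fin n → F) :
    Submodule.span 𝒪[F] (Set.range fun j : Fin n => (τ ^ (j : ℕ)) *ᵥ w) =
      Submodule.span 𝒪[F] (Set.range (Matrix.of fun i j : Fin n => ((τ ^ (j : ℕ)) *ᵥ w) i)ᵀ) := rfl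

omit [ValuativeRel F] in
/-- The Krylov matrix of `a w` for `a` commuting with `τ` is `a · K(w)`: `(a K(w))_{·j} = a τ^j w = τ^j (a w)`. [cite: HornJohnson2013, §3.2.4] -/
theorem mul_krylov_eq_of_commute (τ a : Matrix (Fin n) (Fin n) F) (h : Commute a τ) (w : Fin n → F) :
    a * (Matrix.of fun i j : Fin n => ((τ ^ (j : ℕ)) *ᵥ w) i) = Matrix.of fun i j : Fin n => ((τ ^ (j : ℕ)) *ᵥ (a *ᵥ w)) i := by
  ext i j
  have hcol : (fun k => (Matrix.of fun i j : Fin n => ((τ ^ (j : ℕ)) *ᵥ w) i) k j) = (τ ^ (j : ℕ)) *ᵥ w := rfl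
  rw [Matrix.mul_apply, Matrix.of_apply, Matrix.mulVec_mulVec, ← (h.pow_right (j : ℕ)).eq, ← Matrix.mulVec_mulVec]
  simp only [Matrix.of_apply]
  rfl

/-- **`L(a w) = a · L(w)`** for `a` commuting with `τ`. [cite: HornJohnson2013, §3.2.4] [cite: Serre1980Trees, Ch. II §1.1] -/
theorem map_span_range_pow_mulVec_of_commute (τ a : Matrix (Fin n) (Fin n) F) (h : Commute a τ) (w : Fin n → F) :
    (Submodule.span 𝒪[F] (Set.range fun j : Fin n => (τ ^ (j : ℕ)) *ᵥ w)).map ((Matrix.toLin' a).restrictScalars 𝒪[F]) =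
      Submodule.span 𝒪[F] (Set.range fun j : Fin n => (τ ^ (j : ℕ)) *ᵥ (a *ᵥ w)) := by
  have hcomp : (⇑((Matrix.toLin' a).restrictScalars 𝒪[F]) ∘ fun j : Fin n => (τ ^ (j : ℕ)) *ᵥ w) = fun j : Fin n => (τ ^ (j : ℕ)) *ᵥ (a *ᵥ w) := by
    funext j
    rw [Function.comp_apply, LinearMap.coe_restrictScalars, Matrix.toLin'_apply, Matrix.mulVec_mulVec, Matrix.mulVec_mulVec, (h.pow_right (j : ℕ)).eq]
  rw [Submodule.map_span, ← Set.range_comp, hcomp]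

/-- **`𝒪[τ] · L(w) ≤ L(w)`** when `τ` has INTEGRAL characteristic polynomial: Cayley–Hamilton puts `τⁿ w` in `⊕_{j<n} 𝒪·τ^j w`, and the stabiliser of `L(w)` is a
subalgebra containing `𝒪` and `τ`. [cite: HornJohnson2013, Thm 2.4.3.2] [cite: Serre1980Trees, Ch. II §1.1] -/
theorem map_span_range_pow_mulVec_le_of_mem_adjoin (τ : Matrix (Fin n) (Fin n) F) (hint : ∀ i, τ.charpoly.coeff i ∈ 𝒪[F]) (w : Fin n → F)
    {r : Matrix (Fin n) (Fin n) F} (hr : r ∈ Algebra.adjoin 𝒪[F] ({τ} : Set (Matrix (Fin n) (Fin n) F))) :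
    (Submodule.span 𝒪[F] (Set.range fun j : Fin n => (τ ^ (j : ℕ)) *ᵥ w)).map ((Matrix.toLin' r).restrictScalars 𝒪[F]) ≤
      Submodule.span 𝒪[F] (Set.range fun j : Fin n => (τ ^ (j : ℕ)) *ᵥ w) := by
  set L := Submodule.span 𝒪[F] (Set.range fun j : Fin n => (τ ^ (j : ℕ)) *ᵥ w) with hL
  have hdeg : τ.charpoly.natDegree = n := by rw [Matrix.charpoly_natDegree_eq_dim, Fintype.card_fin]
  have hmonic : τ.charpoly.coeff n = 1 := by
    have h := (Matrix.charpoly_monic τ).coeff_natDegree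
    rwa [hdeg] at h
  have hsmul : ∀ (c : F), c ∈ 𝒪[F] → ∀ x ∈ L, c • x ∈ L := fun c hc x hx => Submodule.smul_mem _ (⟨c, hc⟩ : 𝒪[F]) hx
  -- Cayley–Hamilton: `τ^n w ∈ L`
  have hCH : τ ^ n = -∑ i ∈ Finset.range n, τ.charpoly.coeff i • τ ^ i := by
    have h := Matrix.aeval_self_charpoly τ
    rw [Polynomial.aeval_eq_sum_range, hdeg, Finset.sum_range_succ, hmonic, one_smul] at h
    exact eq_neg_of_add_eq_zero_right h
  have hn_mem : (τ ^ n) *ᵥ w ∈ L := by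
    rw [hCH, Matrix.neg_mulVec, Matrix.sum_mulVec]
    refine Submodule.neg_mem _ (Submodule.sum_mem _ fun i hi => ?_)
    rw [Matrix.smul_mulVec]
    exact hsmul _ (hint i) _ (Submodule.subset_span ⟨⟨i, Finset.mem_range.1 hi⟩, rfl⟩)
  -- the stabiliser predicate, closed under the generators of `𝒪[τ]`
  have key : ∀ s ∈ Algebra.adjoin 𝒪[F] ({τ} : Set (Matrix (Fin n) (Fin n) F)), ∀ x ∈ L, s *ᵥ x ∈ L := by
    intro s hs
    refine Algebra.adjoin_induction (p := fun s _ => ∀ x ∈ L, s *ᵥ x ∈ L) ?_ ?_ ?_ ?_ hs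
    · intro s hs' x hx
      rw [Set.mem_singleton_iff] at hs'
      subst hs'
      refine Submodule.span_induction ?_ ?_ ?_ ?_ hx
      · rintro _ ⟨j, rfl⟩
        rw [Matrix.mulVec_mulVec, ← pow_succ']
        by_cases hj : (j : ℕ) + 1 < n
        · exact Submodule.subset_span ⟨⟨(j : ℕ) + 1, hj⟩, rfl⟩
        · have hjn : (j : ℕ) + 1 = n := by have := j.2; omega
          rw [hjn]
          exact hn_mem
      · rw [Matrix.mulVec_zero]; exact Submodule.zero_mem _
      · intro x y _ _ hx hy
        rw [Matrix.mulVec_add]; exact Submodule.add_mem _ hx hy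
      · intro c x _ hx
        rw [show c • x = (c : F) • x from rfl, Matrix.mulVec_smul]
        exact hsmul _ c.2 _ hx
    · intro c x hx
      rw [Algebra.algebraMap_eq_smul_one, Matrix.smul_mulVec, Matrix.one_mulVec, show c • x = (c : F) • x from rfl]
      exact hsmul _ c.2 _ hx
    · intro s t _ _ hs ht x hx
      rw [Matrix.add_mulVec]; exact Submodule.add_mem _ (hs x hx) (ht x hx)
    · intro s t _ _ hs ht x hx
      rw [← Matrix.mulVec_mulVec]; exact hs _ (ht x hx)
  rw [Submodule.map_le_iff_le_comap]
  intro x hx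
  rw [Submodule.mem_comap, LinearMap.coe_restrictScalars, Matrix.toLin'_apply]
  exact key r hr x hx

/-- **`ρ · L(w) = L(w)` for a UNIT `ρ` of `𝒪[τ]`** (`ρ, ρ⁻¹ ∈ 𝒪[τ]`). [cite: Serre1980Trees, Ch. II §1.1] -/
theorem map_span_range_pow_mulVec_eq_of_mem_units_adjoin (τ : Matrix (Fin n) (Fin n) F) (hint : ∀ i, τ.charpoly.coeff i ∈ 𝒪[F]) (w : Fin n → F)
    (ρ : GL (Fin n) F) (hρ : (ρ : Matrix (Fin n) (Fin n) F) ∈ Algebra.adjoin 𝒪[F] ({τ} : Set (Matrix (Fin n) (Fin n) F)))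
    (hρ' : ((ρ⁻¹ : GL (Fin n) F) : Matrix (Fin n) (Fin n) F) ∈ Algebra.adjoin 𝒪[F] ({τ} : Set (Matrix (Fin n) (Fin n) F))) :
    (Submodule.span 𝒪[F] (Set.range fun j : Fin n => (τ ^ (j : ℕ)) *ᵥ w)).map ((Matrix.toLin' (ρ : Matrix (Fin n) (Fin n) F)).restrictScalars 𝒪[F]) =
      Submodule.span 𝒪[F] (Set.range fun j : Fin n => (τ ^ (j : ℕ)) *ᵥ w) := by
  refine le_antisymm (map_span_range_pow_mulVec_le_of_mem_adjoin τ hint w hρ) fun x hx => ?_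
  refine ⟨((ρ⁻¹ : GL (Fin n) F) : Matrix (Fin n) (Fin n) F) *ᵥ x, map_span_range_pow_mulVec_le_of_mem_adjoin τ hint w hρ' ⟨x, hx, rfl⟩, ?_⟩
  rw [LinearMap.coe_restrictScalars, Matrix.toLin'_apply, Matrix.mulVec_mulVec, ← Units.val_mul, mul_inv_cancel, Units.val_one, Matrix.one_mulVec]

omit [ValuativeRel F] in
/-- **An element commuting with `τ` is determined by its value on a cyclic vector**: `a τ = τ a`, `a w₀ = 0`, `K(w₀)` invertible ⟹ `a = 0` (`a K(w₀) = K(a w₀) = 0`).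
[cite: HornJohnson2013, §3.2.4] -/
theorem eq_zero_of_commute_of_mulVec_eq_zero (τ a : Matrix (Fin n) (Fin n) F) (h : Commute a τ) {w₀ : Fin n → F}
    (hK : IsUnit (Matrix.of fun i j : Fin n => ((τ ^ (j : ℕ)) *ᵥ w₀) i).det) (ha : a *ᵥ w₀ = 0) : a = 0 := by
  have hmul := mul_krylov_eq_of_commute τ a h w₀
  rw [ha] at hmul
  have hzero : (Matrix.of fun i j : Fin n => ((τ ^ (j : ℕ)) *ᵥ (0 : Fin n → F)) i) = 0 := by
    ext i j; simp [Matrix.mulVec_zero]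
  rw [hzero] at hmul
  have hdet : (Matrix.of fun i j : Fin n => ((τ ^ (j : ℕ)) *ᵥ w₀) i).det ≠ 0 := hK.ne_zero
  calc a = a * (Matrix.of fun i j : Fin n => ((τ ^ (j : ℕ)) *ᵥ w₀) i) * (Matrix.of fun i j : Fin n => ((τ ^ (j : ℕ)) *ᵥ w₀) i)⁻¹ := by
        rw [Matrix.mul_assoc, Matrix.mul_nonsing_inv _ (Ne.isUnit hdet), Matrix.mul_one]
    _ = 0 := by rw [hmul, Matrix.zero_mul]

omit [ValuativeRel F] in
/-- **The cyclic-vector torsor, existence**: for a cyclic `w₀` every vector is `r w₀` with `r = Σ_j c_j τ^j`, `c = K(w₀)⁻¹ w`. [cite: HornJohnson2013, §3.2.4] -/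
theorem exists_sum_smul_pow_mulVec_eq (τ : Matrix (Fin n) (Fin n) F) {w₀ : Fin n → F}
    (hK : IsUnit (Matrix.of fun i j : Fin n => ((τ ^ (j : ℕ)) *ᵥ w₀) i).det) (w : Fin n → F) :
    ∃ c : Fin n → F, (∑ j : Fin n, c j • τ ^ (j : ℕ)) *ᵥ w₀ = w := by
  set K := Matrix.of fun i j : Fin n => ((τ ^ (j : ℕ)) *ᵥ w₀) i with hKdef
  refine ⟨K⁻¹ *ᵥ w, ?_⟩
  have hcols : ∀ j : Fin n, Kᵀ j = (τ ^ (j : ℕ)) *ᵥ w₀ := fun j => rfl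
  calc (∑ j : Fin n, (K⁻¹ *ᵥ w) j • τ ^ (j : ℕ)) *ᵥ w₀ = ∑ j : Fin n, (K⁻¹ *ᵥ w) j • ((τ ^ (j : ℕ)) *ᵥ w₀) := by
        rw [Matrix.sum_mulVec]; exact Finset.sum_congr rfl fun j _ => by rw [Matrix.smul_mulVec]
    _ = K *ᵥ (K⁻¹ *ᵥ w) := by
        rw [mulVec_eq_sum_smul_transpose K (K⁻¹ *ᵥ w)]; rfl
    _ = w := by rw [Matrix.mulVec_mulVec, Matrix.mul_nonsing_inv _ hK, Matrix.one_mulVec]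

/-- **The STABILISER of `L(w₀)` among the elements commuting with `τ` is the order `𝒪[τ]`**: if `a τ = τ a` and `a w₀ ∈ L(w₀)` (`w₀` cyclic) then `a ∈ 𝒪[τ]`
(`a w₀ = Σ c_j τ^j w₀` with `c ∈ 𝒪ⁿ`, and `a = Σ c_j τ^j` by the cyclic-vector uniqueness). [cite: Serre1980Trees, Ch. II §1.1] [cite: HornJohnson2013, §3.2.4] -/
theorem mem_adjoin_integer_of_commute_of_mulVec_mem (τ a : Matrix (Fin n) (Fin n) F) (h : Commute a τ) {w₀ : Fin n → F}
    (hK : IsUnit (Matrix.of fun i j : Fin n => ((τ ^ (j : ℕ)) *ᵥ w₀) i).det)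
    (ha : a *ᵥ w₀ ∈ Submodule.span 𝒪[F] (Set.range fun j : Fin n => (τ ^ (j : ℕ)) *ᵥ w₀)) :
    a ∈ Algebra.adjoin 𝒪[F] ({τ} : Set (Matrix (Fin n) (Fin n) F)) := by
  obtain ⟨c, hc⟩ := (Submodule.mem_span_range_iff_exists_fun 𝒪[F]).1 ha
  set r : Matrix (Fin n) (Fin n) F := ∑ j : Fin n, (c j : F) • τ ^ (j : ℕ) with hr
  have hrmem : r ∈ Algebra.adjoin 𝒪[F] ({τ} : Set (Matrix (Fin n) (Fin n) F)) := by
    refine Subalgebra.sum_mem _ fun j _ => ?_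
    rw [show (c j : F) • τ ^ (j : ℕ) = c j • τ ^ (j : ℕ) from rfl]
    exact Subalgebra.smul_mem _ (Subalgebra.pow_mem _ (Algebra.self_mem_adjoin_singleton _ _) _) _
  have hrτ : Commute r τ := by
    refine Commute.sum_left _ _ _ fun j _ => ?_
    exact ((Commute.refl τ).pow_left (j : ℕ)).smul_left _
  have hrw : r *ᵥ w₀ = a *ᵥ w₀ := by
    rw [← hc, hr, Matrix.sum_mulVec]
    exact Finset.sum_congr rfl fun j _ => by rw [Matrix.smul_mulVec]; rfl
  have h0 : a - r = 0 :=
    eq_zero_of_commute_of_mulVec_eq_zero τ (a - r) (h.sub_left hrτ) hK (by rw [Matrix.sub_mulVec, hrw, sub_self])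
  rw [sub_eq_zero] at h0
  rw [h0]
  exact hrmem

/-- **A full lattice `Λ(g) = L(w)` forces `w` to be cyclic**: if the column span of an invertible `g` equals `L(w)` then `K(w)` is invertible (`g = K(w)·P` with `P ∈ M_n(𝒪)`).
[cite: Serre1980Trees, Ch. II §1.1] -/
theorem isUnit_det_of_span_range_transpose_eq (g : GL (Fin n) F) (M : Matrix (Fin n) (Fin n) F)
    (h : Submodule.span 𝒪[F] (Set.range ((g : Matrix (Fin n) (Fin n) F))ᵀ) = Submodule.span 𝒪[F] (Set.range Mᵀ)) : IsUnit M.det := by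
  have hcol : ∀ j : Fin n, ∃ c : Fin n → 𝒪[F], ∑ k, c k • Mᵀ k = ((g : Matrix (Fin n) (Fin n) F))ᵀ j := fun j =>
    (Submodule.mem_span_range_iff_exists_fun 𝒪[F]).1 (h ▸ Submodule.subset_span ⟨j, rfl⟩)
  choose c hc using hcol
  have hg : (g : Matrix (Fin n) (Fin n) F) = M * Matrix.of fun k j => (c j k : F) := by
    ext i j
    have hij := congr_fun (hc j) i
    rw [Finset.sum_apply] at hij
    rw [Matrix.mul_apply, ← show ((g : Matrix (Fin n) (Fin n) F))ᵀ j i = (g : Matrix (Fin n) (Fin n) F) i j from rfl, ← hij]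
    exact Finset.sum_congr rfl fun k _ => by rw [Matrix.of_apply, mul_comm]; rfl
  have hdet : (g : Matrix (Fin n) (Fin n) F).det = M.det * (Matrix.of fun k j => (c j k : F)).det := by rw [hg, Matrix.det_mul]
  exact isUnit_of_mul_isUnit_left (hdet ▸ (Matrix.isUnits_det_units g))

/-- **The inverse of an invertible matrix is a polynomial in it**: `M⁻¹ = −p(0)⁻¹·(p∕X)(M) ∈ E[M]`, `p = charpoly M` (Cayley–Hamilton, `p(0) = ± det M ≠ 0`).
[cite: HornJohnson2013, Thm 2.4.3.2] -/
theorem nonsing_inv_mem_adjoin {K : Type*} [Field K] (M : Matrix (Fin n) (Fin n) K) (hM : IsUnit M.det) :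
    M⁻¹ ∈ Algebra.adjoin K ({M} : Set (Matrix (Fin n) (Fin n) K)) := by
  have hc0 : M.charpoly.coeff 0 ≠ 0 := fun h0 => hM.ne_zero (by rw [Matrix.det_eq_sign_charpoly_coeff, h0, mul_zero])
  have hMB : M * (-(M.charpoly.coeff 0)⁻¹ • Polynomial.aeval M M.charpoly.divX) = 1 := by
    have h := Matrix.aeval_self_charpoly M
    conv_lhs at h => rw [← Polynomial.X_mul_divX_add M.charpoly]
    rw [map_add, map_mul, Polynomial.aeval_X, Polynomial.aeval_C, Algebra.algebraMap_eq_smul_one, add_eq_zero_iff_eq_neg] at h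
    rw [Matrix.mul_smul, h, smul_neg, neg_smul, neg_neg, smul_smul, inv_mul_cancel₀ hc0, one_smul]
  have hinv : M⁻¹ = -(M.charpoly.coeff 0)⁻¹ • Polynomial.aeval M M.charpoly.divX :=
    Matrix.inv_eq_right_inv hMB
  rw [hinv]
  exact Subalgebra.smul_mem _ (Polynomial.aeval_mem_adjoin_singleton K M) _

end Cyclic

/-! ## §2 The torsor of good elements over an abstract commutative carrier `B → M_n(E)` and the count `[C : R_B^×]` -/

section Torsor

variable {E : Type*} [Field E] [ValuativeRel E] {n : ℕ} (σ : E →+* E)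
  {B : Type*} [CommRing B] [Algebra E B]

omit [ValuativeRel E] in
/-- **Gram matrices through the adjoint**: if `J·φ(b⋆) = σ(φ b)ᵀ·J` then `formCongr σ g J = J·φ(b⋆ b)` for `↑g = φ b`. [cite: Jacobowitz1962, §7] -/
theorem formCongr_eq_mul_of_adjoint (J : GL (Fin n) E) (φ : B →ₐ[E] Matrix (Fin n) (Fin n) E) (star : B →+* B)
    (hstar : ∀ b, (J : Matrix (Fin n) (Fin n) E) * φ (star b) = ((φ b).map σ)ᵀ * J) (b : Bˣ) :
    formCongr σ (Units.map (φ : B →* Matrix (Fin n) (Fin n) E) b) (J : Matrix (Fin n) (Fin n) E) =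
      (J : Matrix (Fin n) (Fin n) E) * φ (star (b : B) * b) := by
  rw [formCongr, Units.coe_map, MonoidHom.coe_coe, ← hstar, map_mul, Matrix.mul_assoc]

omit [ValuativeRel E] in
/-- For `u ∈ U(σ,J)`: `formCongr σ u (J ρ) = J · u⁻¹ ρ u` (`σ(u)ᵀ J = J u⁻¹`). [cite: Jacobowitz1962, §7] -/
theorem formCongr_mul_of_mem_unitary (J : GL (Fin n) E) {u : GL (Fin n) E} (hu : u ∈ unitaryGroupOfForm σ (J : Matrix (Fin n) (Fin n) E))
    (ρ : Matrix (Fin n) (Fin n) E) :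
    formCongr σ u ((J : Matrix (Fin n) (Fin n) E) * ρ) = (J : Matrix (Fin n) (Fin n) E) * (((u⁻¹ : GL (Fin n) E) : Matrix (Fin n) (Fin n) E) * ρ * u) := by
  have hu' : ((u : Matrix (Fin n) (Fin n) E).map σ)ᵀ * (J : Matrix (Fin n) (Fin n) E) =
      (J : Matrix (Fin n) (Fin n) E) * ((u⁻¹ : GL (Fin n) E) : Matrix (Fin n) (Fin n) E) := by
    have h := mem_unitaryGroupOfForm_iff.1 hu
    calc ((u : Matrix (Fin n) (Fin n) E).map σ)ᵀ * (J : Matrix (Fin n) (Fin n) E)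
        = ((u : Matrix (Fin n) (Fin n) E).map σ)ᵀ * (J : Matrix (Fin n) (Fin n) E) * (u : Matrix (Fin n) (Fin n) E) * ((u⁻¹ : GL (Fin n) E) : Matrix (Fin n) (Fin n) E) := by
          rw [Matrix.mul_assoc, ← Units.val_mul, mul_inv_cancel, Units.val_one, Matrix.mul_one]
      _ = (J : Matrix (Fin n) (Fin n) E) * ((u⁻¹ : GL (Fin n) E) : Matrix (Fin n) (Fin n) E) := by rw [h]
  rw [formCongr, ← Matrix.mul_assoc, hu']
  simp only [Matrix.mul_assoc]

variable (hσσ : ∀ x, σ (σ x) = x) (hσO : ∀ x : 𝒪[E], σ x ∈ 𝒪[E])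
  (htr : ∃ b : 𝒪[E], (b : E) + σ b = 1) (hnorm : ∀ u : 𝒪[E], IsUnit u → σ u = u → ∃ t : 𝒪[E], (t : E) * σ t = u)
  (J : GL (Fin n) E) (hJ : J ∈ glInt n E) (hJh : ((J : Matrix (Fin n) (Fin n) E).map σ)ᵀ = J)
  (τ : Matrix (Fin n) (Fin n) E) (hint : ∀ i, τ.charpoly.coeff i ∈ 𝒪[E]) {w₀ : Fin n → E}
  (hK : IsUnit (Matrix.of fun i j : Fin n => ((τ ^ (j : ℕ)) *ᵥ w₀) i).det)
  (φ : B →ₐ[E] Matrix (Fin n) (Fin n) E) (hφ : Function.Injective φ) (τB : B) (hτB : φ τB = τ)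
  (star : B →+* B) (hstar : ∀ b, (J : Matrix (Fin n) (Fin n) E) * φ (star b) = ((φ b).map σ)ᵀ * J)
  (RB : Subring B) (hRB : ∀ x, x ∈ Algebra.adjoin 𝒪[E] ({τ} : Set (Matrix (Fin n) (Fin n) E)) ↔ ∃ b ∈ RB, φ b = x)

omit [ValuativeRel E] in
include hτB in
/-- Every `φ b` commutes with `τ = φ τ_B` (`B` is commutative). [cite: HornJohnson2013, §3.2.4] -/
theorem commute_map_of_eq (b : B) : Commute (φ b) τ := by
  rw [← hτB]; exact (Commute.all b τB).map φ

include hint hRB in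
/-- **The order read on units**: `φ ρ` and `φ ρ⁻¹` lie in `𝒪[τ]` iff `ρ ∈ R_B^×`; in particular `φ(ρ)·L(w) = L(w)` for `ρ ∈ R_B^×`. [cite: Serre1980Trees, Ch. II §1.1] -/
theorem map_span_range_pow_mulVec_eq_of_mem_units (ρ : Bˣ) (hρ : ρ ∈ RB.toSubmonoid.units) (w : Fin n → E) :
    (Submodule.span 𝒪[E] (Set.range fun j : Fin n => (τ ^ (j : ℕ)) *ᵥ w)).map
        ((Matrix.toLin' (φ (ρ : B))).restrictScalars 𝒪[E]) =
      Submodule.span 𝒪[E] (Set.range fun j : Fin n => (τ ^ (j : ℕ)) *ᵥ w) := by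
  rw [Submonoid.mem_units_iff] at hρ
  have h1 : φ (ρ : B) ∈ Algebra.adjoin 𝒪[E] ({τ} : Set (Matrix (Fin n) (Fin n) E)) := (hRB _).2 ⟨_, hρ.1, rfl⟩
  have h2 : φ ((ρ⁻¹ : Bˣ) : B) ∈ Algebra.adjoin 𝒪[E] ({τ} : Set (Matrix (Fin n) (Fin n) E)) := (hRB _).2 ⟨_, hρ.2, rfl⟩
  have h := map_span_range_pow_mulVec_eq_of_mem_units_adjoin τ hint w (Units.map (φ : B →* Matrix (Fin n) (Fin n) E) ρ)
    (by rw [Units.coe_map, MonoidHom.coe_coe]; exact h1) (by rw [← map_inv, Units.coe_map, MonoidHom.coe_coe]; exact h2)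
  rw [Units.coe_map, MonoidHom.coe_coe] at h
  exact h

include hint hφ hτB hRB hK in
/-- **Stabiliser on units**: for `d : Bˣ`, `φ(d)·L(w₀) = L(w₀)` forces `d ∈ R_B^×` (★ §1 stabiliser, applied to `φ d` and `φ d⁻¹`). [cite: Serre1980Trees, Ch. II §1.1] -/
theorem mem_units_of_map_span_eq (d : Bˣ)
    (hd : (Submodule.span 𝒪[E] (Set.range fun j : Fin n => (τ ^ (j : ℕ)) *ᵥ w₀)).map ((Matrix.toLin' (φ (d : B))).restrictScalars 𝒪[E]) =
      Submodule.span 𝒪[E] (Set.range fun j : Fin n => (τ ^ (j : ℕ)) *ᵥ w₀)) :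
    d ∈ RB.toSubmonoid.units := by
  set L := Submodule.span 𝒪[E] (Set.range fun j : Fin n => (τ ^ (j : ℕ)) *ᵥ w₀) with hL
  -- `w₀ ∈ L(w₀)`
  have hw₀ : w₀ ∈ L := by
    rcases Nat.eq_zero_or_pos n with h0 | h0
    · subst h0
      have hw : w₀ = 0 := funext fun i => Fin.elim0 i
      rw [hw]; exact Submodule.zero_mem _
    · have h : (τ ^ ((⟨0, h0⟩ : Fin n) : ℕ)) *ᵥ w₀ ∈ L := Submodule.subset_span ⟨⟨0, h0⟩, rfl⟩
      rwa [show ((⟨0, h0⟩ : Fin n) : ℕ) = 0 from rfl, pow_zero, Matrix.one_mulVec] at h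
  -- `φ d`, `φ d⁻¹` stabilise `L(w₀)`
  have hdinv : (L.map ((Matrix.toLin' (φ ((d⁻¹ : Bˣ) : B))).restrictScalars 𝒪[E])) = L := by
    have h := congrArg (Submodule.map ((Matrix.toLin' (φ ((d⁻¹ : Bˣ) : B))).restrictScalars 𝒪[E])) hd
    rw [← Submodule.map_comp] at h
    have hcomp : ((Matrix.toLin' (φ ((d⁻¹ : Bˣ) : B))).restrictScalars 𝒪[E]).comp ((Matrix.toLin' (φ (d : B))).restrictScalars 𝒪[E]) = LinearMap.id := by
      apply LinearMap.ext; intro x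
      simp only [LinearMap.coe_comp, Function.comp_apply, LinearMap.coe_restrictScalars, Matrix.toLin'_apply, Matrix.mulVec_mulVec, LinearMap.id_coe, id_eq]
      rw [← map_mul, Units.inv_mul, map_one, Matrix.one_mulVec]
    rw [hcomp, Submodule.map_id] at h
    exact h.symm
  have hmem : ∀ {e : Bˣ}, (L.map ((Matrix.toLin' (φ (e : B))).restrictScalars 𝒪[E])) = L →
      φ (e : B) ∈ Algebra.adjoin 𝒪[E] ({τ} : Set (Matrix (Fin n) (Fin n) E)) := by
    intro e he
    refine mem_adjoin_integer_of_commute_of_mulVec_mem τ (φ (e : B)) (commute_map_of_eq τ φ τB hτB _) hK ?_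
    show φ (e : B) *ᵥ w₀ ∈ L
    rw [← he]
    exact ⟨w₀, hw₀, rfl⟩
  have hin : ∀ {e : Bˣ}, φ (e : B) ∈ Algebra.adjoin 𝒪[E] ({τ} : Set (Matrix (Fin n) (Fin n) E)) → (e : B) ∈ RB := by
    intro e he
    obtain ⟨b, hb, hbe⟩ := (hRB _).1 he
    rw [← hφ hbe]; exact hb
  rw [Submonoid.mem_units_iff]
  exact ⟨hin (hmem hd), hin (hmem hdinv)⟩

include hσσ hσO htr hnorm hJ hJh hint hτB hstar hRB in
/-- **C-STABILITY OF THE GOOD ELEMENTS**: if `L(φ(b) w₀)` is self-dual and `c c⋆ ∈ R_B^×` then `L(φ(c b) w₀)` is self-dual — its Gram matrix in the frame `φ(c)·u` is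
`J·(u⁻¹ ρ u)`, `ρ = φ(c c⋆)`, and `u⁻¹ρu ∈ GL_n(𝒪)` since `ρ` stabilises the `𝒪[τ]`-module `Λ(u)` (★ L1 docking). [cite: Jacobowitz1962, §7 Thm. 7.1]
[cite: Serre1980Trees, Ch. II §1.1] -/
theorem good_mul_of_mem_comap (b c : Bˣ)
    (hb : ∃ u ∈ unitaryGroupOfForm σ (J : Matrix (Fin n) (Fin n) E),
      Submodule.span 𝒪[E] (Set.range fun j : Fin n => (τ ^ (j : ℕ)) *ᵥ (φ (b : B) *ᵥ w₀)) = Submodule.span 𝒪[E] (Set.range ((u : Matrix (Fin n) (Fin n) E))ᵀ))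
    (hc : c ∈ (RB.toSubmonoid.units).comap (MonoidHom.id Bˣ * (Units.map (star : B →+* B).toMonoidHom))) :
    ∃ u ∈ unitaryGroupOfForm σ (J : Matrix (Fin n) (Fin n) E),
      Submodule.span 𝒪[E] (Set.range fun j : Fin n => (τ ^ (j : ℕ)) *ᵥ (φ ((c * b : Bˣ) : B) *ᵥ w₀)) = Submodule.span 𝒪[E] (Set.range ((u : Matrix (Fin n) (Fin n) E))ᵀ) := by
  obtain ⟨u, hu, huL'⟩ := hb
  have huL := huL'.symm
  rw [Subgroup.mem_comap] at hc
  set ρ : Bˣ := (MonoidHom.id Bˣ * (Units.map (star : B →+* B).toMonoidHom)) c with hρdef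
  have hρval : (ρ : B) = c * star c := by
    rw [hρdef, MonoidHom.mul_apply, MonoidHom.id_apply, Units.val_mul, Units.coe_map]; rfl
  set cu : GL (Fin n) E := Units.map (φ : B →* Matrix (Fin n) (Fin n) E) c with hcu
  set ρu : GL (Fin n) E := Units.map (φ : B →* Matrix (Fin n) (Fin n) E) ρ with hρu
  have hcu_val : (cu : Matrix (Fin n) (Fin n) E) = φ (c : B) := by rw [hcu, Units.coe_map, MonoidHom.coe_coe]
  have hρu_val : (ρu : Matrix (Fin n) (Fin n) E) = φ (ρ : B) := by rw [hρu, Units.coe_map, MonoidHom.coe_coe]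
  -- the new lattice is `Λ(cu * u)`
  have hnew : Submodule.span 𝒪[E] (Set.range fun j : Fin n => (τ ^ (j : ℕ)) *ᵥ (φ ((c * b : Bˣ) : B) *ᵥ w₀)) =
      Submodule.span 𝒪[E] (Set.range (((cu * u : GL (Fin n) E) : Matrix (Fin n) (Fin n) E))ᵀ) := by
    rw [Units.val_mul, map_mul, ← Matrix.mulVec_mulVec, ← map_span_range_pow_mulVec_of_commute τ (φ (c : B)) (commute_map_of_eq τ φ τB hτB _),
      ← huL, Units.val_mul, span_range_transpose_mul, hcu_val]
  -- `ρ` stabilises `Λ(u) = L(φ b w₀)`, so `u⁻¹ ρu u ∈ GL_n(𝒪)`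
  have hstab : Submodule.span 𝒪[E] (Set.range ((u : Matrix (Fin n) (Fin n) E))ᵀ) =
      Submodule.span 𝒪[E] (Set.range (((ρu * u : GL (Fin n) E) : Matrix (Fin n) (Fin n) E))ᵀ) := by
    rw [Units.val_mul, span_range_transpose_mul, huL, hρu_val, map_span_range_pow_mulVec_eq_of_mem_units τ hint φ RB hRB ρ hc]
  have hk : u⁻¹ * (ρu * u) ∈ glInt n E := (span_range_transpose_eq_iff u (ρu * u)).1 hstab
  -- the Gram matrix of `cu * u` is `J · u⁻¹ ρu u`
  have hgram : formCongr σ (cu * u) (J : Matrix (Fin n) (Fin n) E) = (((J * (u⁻¹ * (ρu * u)) : GL (Fin n) E)) : Matrix (Fin n) (Fin n) E) := by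
    rw [formCongr_mul_eq_formCongr_formCongr, hcu, formCongr_eq_mul_of_adjoint σ J φ star hstar c, mul_comm (star (c : B)) _, ← hρval, ← hρu_val,
      formCongr_mul_of_mem_unitary σ J hu]
    simp only [Units.val_mul, Matrix.mul_assoc]
  -- ★ L1 docking
  refine (exists_mem_unitary_span_eq_iff_selfDual σ J hσσ hσO htr hnorm hJ hJh _).2 ⟨cu * u, ⟨J * (u⁻¹ * (ρu * u)), mul_mem hJ hk, hgram.symm⟩, hnew⟩

include hτB in
/-- **Cancellation**: if `φ(x)` fixes the lattice `L(φ(b) w₀) = φ(b)·L(w₀)` (`b ∈ Bˣ`) then it fixes `L(w₀)` (`φ(x)`, `φ(b)` commute; `φ(b)` is invertible).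
[cite: Serre1980Trees, Ch. II §1.1] -/
theorem map_span_eq_self_of_map_span_mul_eq (b : Bˣ) (x : B)
    (h : (Submodule.span 𝒪[E] (Set.range fun j : Fin n => (τ ^ (j : ℕ)) *ᵥ (φ (b : B) *ᵥ w₀))).map ((Matrix.toLin' (φ x)).restrictScalars 𝒪[E]) =
      Submodule.span 𝒪[E] (Set.range fun j : Fin n => (τ ^ (j : ℕ)) *ᵥ (φ (b : B) *ᵥ w₀))) :
    (Submodule.span 𝒪[E] (Set.range fun j : Fin n => (τ ^ (j : ℕ)) *ᵥ w₀)).map ((Matrix.toLin' (φ x)).restrictScalars 𝒪[E]) =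
      Submodule.span 𝒪[E] (Set.range fun j : Fin n => (τ ^ (j : ℕ)) *ᵥ w₀) := by
  set bu : GL (Fin n) E := Units.map (φ : B →* Matrix (Fin n) (Fin n) E) b with hbu
  have hbu_val : (bu : Matrix (Fin n) (Fin n) E) = φ (b : B) := by rw [hbu, Units.coe_map, MonoidHom.coe_coe]
  have hLb : Submodule.span 𝒪[E] (Set.range fun j : Fin n => (τ ^ (j : ℕ)) *ᵥ (φ (b : B) *ᵥ w₀)) =
      (Submodule.span 𝒪[E] (Set.range fun j : Fin n => (τ ^ (j : ℕ)) *ᵥ w₀)).map ((Matrix.toLin' (bu : Matrix (Fin n) (Fin n) E)).restrictScalars 𝒪[E]) := by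
    rw [hbu_val, map_span_range_pow_mulVec_of_commute τ (φ (b : B)) (commute_map_of_eq τ φ τB hτB _)]
  have hcomm : ((Matrix.toLin' (φ x)).restrictScalars 𝒪[E]).comp ((Matrix.toLin' (bu : Matrix (Fin n) (Fin n) E)).restrictScalars 𝒪[E]) =
      ((Matrix.toLin' (bu : Matrix (Fin n) (Fin n) E)).restrictScalars 𝒪[E]).comp ((Matrix.toLin' (φ x)).restrictScalars 𝒪[E]) := by
    apply LinearMap.ext
    intro v
    simp only [LinearMap.coe_comp, Function.comp_apply, LinearMap.coe_restrictScalars, Matrix.toLin'_apply, Matrix.mulVec_mulVec, hbu_val, ← map_mul,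
      mul_comm x (b : B)]
  rw [hLb, ← Submodule.map_comp, hcomm, Submodule.map_comp] at h
  exact map_toLin'_injective bu h

include hσσ hσO htr hnorm hJ hJh hint hK hφ hτB hstar hRB in
/-- **TRANSITIVITY: two good elements differ by an element of `C`** — if `L(φ(b₀) w₀)` and `L(φ(b₁) w₀)` are both self-dual then `N(b₁ b₀⁻¹) = (b₁b₀⁻¹)(b₁b₀⁻¹)⋆ ∈ R_B^×`:
with `c = b₁b₀⁻¹`, `Λ(u₁) = φ(c)·Λ(u₀)`, so the Gram matrix `J·u₀⁻¹ρu₀` of `φ(c)u₀` (`ρ = φ(N c)`) is unimodular (★ `exists_mem_glInt_coe_eq_formCongr`), `ρ` stabilises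
`Λ(u₀) = φ(b₀)·L(w₀)`, hence `L(w₀)`, hence `ρ^{±1} ∈ 𝒪[τ]`. [cite: Jacobowitz1962, §7] [cite: Serre1980Trees, Ch. II §1.1] -/
theorem mul_inv_mem_comap_of_good_of_good (b₀ b₁ : Bˣ)
    (hb₀ : ∃ u ∈ unitaryGroupOfForm σ (J : Matrix (Fin n) (Fin n) E),
      Submodule.span 𝒪[E] (Set.range fun j : Fin n => (τ ^ (j : ℕ)) *ᵥ (φ (b₀ : B) *ᵥ w₀)) = Submodule.span 𝒪[E] (Set.range ((u : Matrix (Fin n) (Fin n) E))ᵀ))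
    (hb₁ : ∃ u ∈ unitaryGroupOfForm σ (J : Matrix (Fin n) (Fin n) E),
      Submodule.span 𝒪[E] (Set.range fun j : Fin n => (τ ^ (j : ℕ)) *ᵥ (φ (b₁ : B) *ᵥ w₀)) = Submodule.span 𝒪[E] (Set.range ((u : Matrix (Fin n) (Fin n) E))ᵀ)) :
    b₁ * b₀⁻¹ ∈ (RB.toSubmonoid.units).comap (MonoidHom.id Bˣ * (Units.map (star : B →+* B).toMonoidHom)) := by
  obtain ⟨u₀, hu₀, hL₀⟩ := hb₀
  obtain ⟨u₁, hu₁, hL₁⟩ := hb₁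
  set c : Bˣ := b₁ * b₀⁻¹ with hcdef
  rw [Subgroup.mem_comap]
  set ρ : Bˣ := (MonoidHom.id Bˣ * (Units.map (star : B →+* B).toMonoidHom)) c with hρdef
  have hρval : (ρ : B) = c * star c := by
    rw [hρdef, MonoidHom.mul_apply, MonoidHom.id_apply, Units.val_mul, Units.coe_map]; rfl
  set cu : GL (Fin n) E := Units.map (φ : B →* Matrix (Fin n) (Fin n) E) c with hcu
  set ρu : GL (Fin n) E := Units.map (φ : B →* Matrix (Fin n) (Fin n) E) ρ with hρu
  have hcu_val : (cu : Matrix (Fin n) (Fin n) E) = φ (c : B) := by rw [hcu, Units.coe_map, MonoidHom.coe_coe]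
  have hρu_val : (ρu : Matrix (Fin n) (Fin n) E) = φ (ρ : B) := by rw [hρu, Units.coe_map, MonoidHom.coe_coe]
  -- `Λ(cu * u₀) = Λ(u₁)`
  have hb₁c : (b₁ : B) = c * b₀ := by rw [hcdef, Units.val_mul, Units.inv_mul_cancel_right]
  have hΛ : Submodule.span 𝒪[E] (Set.range (((cu * u₀ : GL (Fin n) E) : Matrix (Fin n) (Fin n) E))ᵀ) =
      Submodule.span 𝒪[E] (Set.range ((u₁ : Matrix (Fin n) (Fin n) E))ᵀ) := by
    rw [Units.val_mul, span_range_transpose_mul, hcu_val, ← hL₀, map_span_range_pow_mulVec_of_commute τ (φ (c : B)) (commute_map_of_eq τ φ τB hτB _),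
      ← hL₁, hb₁c, map_mul, ← Matrix.mulVec_mulVec]
  -- the Gram matrix of `cu * u₀` is unimodular (★ docking at `Λ(u₁)`), and equals `J · u₀⁻¹ ρu u₀`
  obtain ⟨g, ⟨J', hJ', hJ'g⟩, hΛg⟩ := (exists_mem_unitary_span_eq_iff_selfDual σ J hσσ hσO htr hnorm hJ hJh _).1 ⟨u₁, hu₁, rfl⟩
  have hk : (cu * u₀)⁻¹ * g ∈ glInt n E := (span_range_transpose_eq_iff (cu * u₀) g).1 (hΛ.trans hΛg)
  obtain ⟨J'', hJ'', hJ''e⟩ := exists_mem_glInt_coe_eq_formCongr σ hσO J' hJ' ((cu * u₀)⁻¹ * g)⁻¹ (inv_mem hk)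
  have hgram : formCongr σ (cu * u₀) (J : Matrix (Fin n) (Fin n) E) = (((J * (u₀⁻¹ * (ρu * u₀)) : GL (Fin n) E)) : Matrix (Fin n) (Fin n) E) := by
    rw [formCongr_mul_eq_formCongr_formCongr, hcu, formCongr_eq_mul_of_adjoint σ J φ star hstar c, mul_comm (star (c : B)) _, ← hρval, ← hρu_val,
      formCongr_mul_of_mem_unitary σ J hu₀]
    simp only [Units.val_mul, Matrix.mul_assoc]
  have hgram' : formCongr σ (cu * u₀) (J : Matrix (Fin n) (Fin n) E) = (J'' : Matrix (Fin n) (Fin n) E) := by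
    rw [hJ''e, hJ'g, ← formCongr_mul_eq_formCongr_formCongr, _root_.mul_inv_rev, inv_inv, mul_inv_cancel_left]
  have hX : J * (u₀⁻¹ * (ρu * u₀)) = J'' := Units.ext (hgram.symm.trans hgram')
  have hXint : u₀⁻¹ * (ρu * u₀) ∈ glInt n E := by
    have h : J⁻¹ * J'' ∈ glInt n E := mul_mem (inv_mem hJ) hJ''
    rwa [← hX, inv_mul_cancel_left] at h
  -- so `ρ` stabilises `Λ(u₀) = L(φ b₀ w₀)`, hence `L(w₀)`
  have hstabΛ : Submodule.span 𝒪[E] (Set.range ((u₀ : Matrix (Fin n) (Fin n) E))ᵀ) =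
      Submodule.span 𝒪[E] (Set.range (((ρu * u₀ : GL (Fin n) E) : Matrix (Fin n) (Fin n) E))ᵀ) := (span_range_transpose_eq_iff u₀ (ρu * u₀)).2 hXint
  have hstab₀ : (Submodule.span 𝒪[E] (Set.range fun j : Fin n => (τ ^ (j : ℕ)) *ᵥ (φ (b₀ : B) *ᵥ w₀))).map
      ((Matrix.toLin' (φ (ρ : B))).restrictScalars 𝒪[E]) = Submodule.span 𝒪[E] (Set.range fun j : Fin n => (τ ^ (j : ℕ)) *ᵥ (φ (b₀ : B) *ᵥ w₀)) := by
    rw [hL₀, ← hρu_val, ← span_range_transpose_mul, ← Units.val_mul]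
    exact hstabΛ.symm
  exact mem_units_of_map_span_eq τ hint hK φ hφ τB hτB RB hRB ρ (map_span_eq_self_of_map_span_mul_eq τ φ τB hτB b₀ (ρ : B) hstab₀)

include hint hK hφ hτB hRB in
/-- **FIBRES**: `L(φ(c b₀) w₀) = L(φ(c′ b₀) w₀) ⟺ c⁻¹c′ ∈ R_B^×` (the stabiliser of `L(w₀)` in `φ(B) = E[τ]` is `𝒪[τ]`). [cite: Serre1980Trees, Ch. II §1.1] -/
theorem span_eq_span_iff_inv_mul_mem_units (b₀ c c' : Bˣ) :
    Submodule.span 𝒪[E] (Set.range fun j : Fin n => (τ ^ (j : ℕ)) *ᵥ (φ ((c * b₀ : Bˣ) : B) *ᵥ w₀)) =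
        Submodule.span 𝒪[E] (Set.range fun j : Fin n => (τ ^ (j : ℕ)) *ᵥ (φ ((c' * b₀ : Bˣ) : B) *ᵥ w₀)) ↔
      c⁻¹ * c' ∈ RB.toSubmonoid.units := by
  set d : Bˣ := c⁻¹ * c' with hd
  have he' : c' * b₀ = d * (c * b₀) := by rw [hd, mul_mul_mul_comm, inv_mul_cancel, one_mul]
  have key : Submodule.span 𝒪[E] (Set.range fun j : Fin n => (τ ^ (j : ℕ)) *ᵥ (φ ((c' * b₀ : Bˣ) : B) *ᵥ w₀)) =
      (Submodule.span 𝒪[E] (Set.range fun j : Fin n => (τ ^ (j : ℕ)) *ᵥ (φ ((c * b₀ : Bˣ) : B) *ᵥ w₀))).map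
        ((Matrix.toLin' (φ (d : B))).restrictScalars 𝒪[E]) := by
    rw [he', Units.val_mul, map_mul, ← Matrix.mulVec_mulVec, map_span_range_pow_mulVec_of_commute τ (φ (d : B)) (commute_map_of_eq τ φ τB hτB _)]
  constructor
  · intro h
    have h2 : (Submodule.span 𝒪[E] (Set.range fun j : Fin n => (τ ^ (j : ℕ)) *ᵥ (φ ((c * b₀ : Bˣ) : B) *ᵥ w₀))).map
        ((Matrix.toLin' (φ (d : B))).restrictScalars 𝒪[E]) =
        Submodule.span 𝒪[E] (Set.range fun j : Fin n => (τ ^ (j : ℕ)) *ᵥ (φ ((c * b₀ : Bˣ) : B) *ᵥ w₀)) := by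
      rw [← key]; exact h.symm
    exact mem_units_of_map_span_eq τ hint hK φ hφ τB hτB RB hRB d (map_span_eq_self_of_map_span_mul_eq τ φ τB hτB (c * b₀) (d : B) h2)
  · intro hd'
    rw [key]
    exact (map_span_range_pow_mulVec_eq_of_mem_units τ hint φ RB hRB d hd' _).symm

include hK hφ hτB in
/-- **EVERY MEMBER OF THE SET IS `L(φ(b) w₀)` FOR A GOOD UNIT `b`**: a self-dual `Λ(u) = L(w)` is a full lattice, so `w` is cyclic (★ §1), `w = r w₀` with `r = Σ c_j τ^j = φ(Σ c_j τ_B^j)`,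
`r` invertible, and `r⁻¹ ∈ E[r] ⊆ φ(B)` makes `Σ c_j τ_B^j` a unit of `B` (`φ` injective).  Contrapositive: NO good unit ⇒ the set is EMPTY. [cite: Serre1980Trees, Ch. II §1.1]
[cite: HornJohnson2013, §3.2.4] -/
theorem exists_units_of_mem {Λ : Submodule 𝒪[E] (Fin n → E)}
    (hΛ : (∃ u ∈ unitaryGroupOfForm σ (J : Matrix (Fin n) (Fin n) E), Λ = Submodule.span 𝒪[E] (Set.range ((u : Matrix (Fin n) (Fin n) E))ᵀ)) ∧
      ∃ w : Fin n → E, Λ = Submodule.span 𝒪[E] (Set.range fun j : Fin n => (τ ^ (j : ℕ)) *ᵥ w)) :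
    ∃ b : Bˣ, (∃ u ∈ unitaryGroupOfForm σ (J : Matrix (Fin n) (Fin n) E),
        Submodule.span 𝒪[E] (Set.range fun j : Fin n => (τ ^ (j : ℕ)) *ᵥ (φ (b : B) *ᵥ w₀)) = Submodule.span 𝒪[E] (Set.range ((u : Matrix (Fin n) (Fin n) E))ᵀ)) ∧
      Λ = Submodule.span 𝒪[E] (Set.range fun j : Fin n => (τ ^ (j : ℕ)) *ᵥ (φ (b : B) *ᵥ w₀)) := by
  obtain ⟨⟨u, hu, huΛ⟩, w, hw⟩ := hΛ
  -- `w` is cyclic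
  have hKw : IsUnit (Matrix.of fun i j : Fin n => ((τ ^ (j : ℕ)) *ᵥ w) i).det :=
    isUnit_det_of_span_range_transpose_eq u _ (huΛ.symm.trans (hw.trans (span_range_pow_mulVec_eq_span_range_transpose τ w)))
  -- `w = r w₀`, `r = Σ c_j τ^j = φ (Σ c_j τ_B^j)`
  obtain ⟨cf, hcf⟩ := exists_sum_smul_pow_mulVec_eq τ hK w
  set r : Matrix (Fin n) (Fin n) E := ∑ j : Fin n, cf j • τ ^ (j : ℕ) with hr
  set br : B := ∑ j : Fin n, cf j • τB ^ (j : ℕ) with hbr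
  have hφbr : φ br = r := by
    rw [hbr, map_sum]
    exact Finset.sum_congr rfl fun j _ => by rw [map_smul, map_pow, hτB]
  have hrτ : Commute r τ := by rw [← hφbr]; exact commute_map_of_eq τ φ τB hτB br
  -- `r` is invertible: `K(w) = r · K(w₀)`
  have hru : IsUnit r.det := by
    have h := mul_krylov_eq_of_commute τ r hrτ w₀
    rw [hcf] at h
    have hdet : (Matrix.of fun i j : Fin n => ((τ ^ (j : ℕ)) *ᵥ w) i).det = r.det * (Matrix.of fun i j : Fin n => ((τ ^ (j : ℕ)) *ᵥ w₀) i).det := by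
      rw [← h, Matrix.det_mul]
    exact isUnit_of_mul_isUnit_left (hdet ▸ hKw)
  -- `r⁻¹ ∈ E[r] = φ(E[br])`
  have hinv : r⁻¹ ∈ (Algebra.adjoin E ({br} : Set B)).map φ := by
    rw [AlgHom.map_adjoin_singleton, hφbr]
    exact nonsing_inv_mem_adjoin r hru
  obtain ⟨b', -, hb'⟩ := Subalgebra.mem_map.1 hinv
  have hunit : br * b' = 1 := hφ (by rw [map_mul, hφbr, hb', map_one, Matrix.mul_nonsing_inv _ hru])
  refine ⟨Units.mkOfMulEqOne br b' hunit, ⟨u, hu, ?_⟩, ?_⟩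
  · rw [Units.val_mkOfMulEqOne, hφbr, hcf, ← hw, huΛ]
  · rw [Units.val_mkOfMulEqOne, hφbr, hcf, ← hw]

include hσσ hσO htr hnorm hJ hJh hint hK hφ hτB hstar hRB in
/-- **THE COUNT `[C : R_B^×]`** (organ [T2-a]): if SOME `b₀ ∈ Bˣ` is good (`L(φ(b₀) w₀)` self-dual), then the self-dual cyclic lattices of `τ` — the ★ rider's set
`{Λ | (∃ u ∈ U(σ,J), Λ = Λ(u)) ∧ ∃ w, Λ = ⊕_{j<n} 𝒪·τ^j w}` of ★ `ncard_fixedBy_unitary_rank_eq_ncard_free'` — number `R_B^×.relIndex C`, `C = {c ∈ Bˣ : c c⋆ ∈ R_B^×}`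
(`Subgroup.comap` of `R_B^× = R_B.toSubmonoid.units` under `id · (⋆ on units)`); ★ (c1) `natCard_range_eq_relIndex_of_fibres` on `c ↦ L(φ(c b₀) w₀)`.
[cite: Jacobowitz1962, §7] [cite: Serre1980Trees, Ch. II §1.1] [cite: Rogawski1990, §4.9 Lemma 4.9.3 p. 56] -/
theorem ncard_setOf_selfDual_cyclic_eq_relIndex (b₀ : Bˣ)
    (hb₀ : ∃ u ∈ unitaryGroupOfForm σ (J : Matrix (Fin n) (Fin n) E),
      Submodule.span 𝒪[E] (Set.range fun j : Fin n => (τ ^ (j : ℕ)) *ᵥ (φ (b₀ : B) *ᵥ w₀)) = Submodule.span 𝒪[E] (Set.range ((u : Matrix (Fin n) (Fin n) E))ᵀ)) :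
    {Λ : Submodule 𝒪[E] (Fin n → E) |
        (∃ u ∈ unitaryGroupOfForm σ (J : Matrix (Fin n) (Fin n) E), Λ = Submodule.span 𝒪[E] (Set.range ((u : Matrix (Fin n) (Fin n) E))ᵀ)) ∧
          ∃ w : Fin n → E, Λ = Submodule.span 𝒪[E] (Set.range fun j : Fin n => (τ ^ (j : ℕ)) *ᵥ w)}.ncard =
      (RB.toSubmonoid.units).relIndex ((RB.toSubmonoid.units).comap (MonoidHom.id Bˣ * (Units.map (star : B →+* B).toMonoidHom))) := by
  set C : Subgroup Bˣ := (RB.toSubmonoid.units).comap (MonoidHom.id Bˣ * (Units.map (star : B →+* B).toMonoidHom)) with hC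
  let f : C → Submodule 𝒪[E] (Fin n → E) := fun c => Submodule.span 𝒪[E] (Set.range fun j : Fin n => (τ ^ (j : ℕ)) *ᵥ (φ (((c : Bˣ) * b₀ : Bˣ) : B) *ᵥ w₀))
  have hS : {Λ : Submodule 𝒪[E] (Fin n → E) |
        (∃ u ∈ unitaryGroupOfForm σ (J : Matrix (Fin n) (Fin n) E), Λ = Submodule.span 𝒪[E] (Set.range ((u : Matrix (Fin n) (Fin n) E))ᵀ)) ∧
          ∃ w : Fin n → E, Λ = Submodule.span 𝒪[E] (Set.range fun j : Fin n => (τ ^ (j : ℕ)) *ᵥ w)} = Set.range f := by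
    ext Λ
    constructor
    · intro hΛ
      obtain ⟨b, hbgood, rfl⟩ := exists_units_of_mem σ J τ hK φ hφ τB hτB hΛ
      have hc : b * b₀⁻¹ ∈ C := mul_inv_mem_comap_of_good_of_good σ hσσ hσO htr hnorm J hJ hJh τ hint hK φ hφ τB hτB star hstar RB hRB b₀ b hb₀ hbgood
      refine ⟨⟨b * b₀⁻¹, hc⟩, ?_⟩
      show Submodule.span 𝒪[E] (Set.range fun j : Fin n => (τ ^ (j : ℕ)) *ᵥ (φ (((b * b₀⁻¹) * b₀ : Bˣ) : B) *ᵥ w₀)) = _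
      rw [inv_mul_cancel_right]
    · rintro ⟨c, rfl⟩
      obtain ⟨u, hu, h⟩ := good_mul_of_mem_comap σ hσσ hσO htr hnorm J hJ hJh τ hint φ τB hτB star hstar RB hRB b₀ (c : Bˣ) hb₀ c.2
      exact ⟨⟨u, hu, h⟩, _, rfl⟩
  rw [hS, ← Nat.card_coe_set_eq]
  exact Literature.GroupTheory.natCard_range_eq_relIndex_of_fibres C (RB.toSubmonoid.units) f fun c c' =>
    span_eq_span_iff_inv_mul_mem_units τ hint hK φ hφ τB hτB RB hRB b₀ (c : Bˣ) (c' : Bˣ)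

end Torsor


end Literature.NumberTheory.Automorphic

end
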